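import Mathlib
import Literature.NumberTheory.Transcendental.GammaIsoCross
import Literature.NumberTheory.Transcendental.ZilberGenericClosedness
import Literature.NumberTheory.Transcendental.PseudoExpVariants
import Literature.NumberTheory.Transcendental.PseudoExpAmbient
import Literature.NumberTheory.Transcendental.GammaFieldsEcl
import Summits.Schanuel.Schanuel.Theorems.RigidCoreAclSubsetLogFreeCoreDoubleBaseAux1
import Summits.Schanuel.Schanuel.Theorems.RigidCoreAclSubsetLogFreeCoreDoubleBaseAux2

/-!
# The double of a free extension inside `ℂ`: the partial exponential `θ` on `W + φ(W)`
(auxiliary file 3 for the stub `stub_doubleBase` of line `eac-extends-core-automorphisms`,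
crux stmt-Schanuel-0968)

Continuing auxiliary file 2 (same local notations `𝕏 = ℚτ + ℚc`, `𝕎 = 𝕏 + ℚe`,
`𝔽 = ℚ(gens 𝕎)`, a field embedding `φ : 𝔽 → ℂ`, `e' = φ ∘ e`; no new definitions). On
`D_ℂ = 𝕎 + ℚe' = 𝕎 + φ(𝕎)` every element is uniquely `w + Σ qⱼ e'ⱼ` (`w ∈ 𝕎`), so there is a
map `θ : ℂ → ℂ` with `θ(w + Σ qⱼ e'ⱼ) = exp w · φ(exp Σ qⱼ eⱼ)` (`exists_theta`; the
characterising property is the hypothesis `hθ` below). Such a `θ` extends `exp` on `𝕎`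
(`theta_of_mem_W`) and `φ ∘ exp ∘ φ⁻¹` on `φ(𝕎)` (`theta_phi`), is a homomorphism
`(D_ℂ, +) → (ℂˣ, ·)` (`theta_add`, `theta_ne_zero`), and its kernel on `D_ℂ` is exactly `ℤτ`
when `τ = 2πi` (`theta_eq_one_iff`: a kernel element has `exp w ∈ φ(𝔽) ∩ 𝔽`, so `w ∈ 𝕏` by
multiplicative freeness, and then the `φ(𝕎)`-component vanishes by linear independence).
Finally: `𝔽` is countable and of finite transcendence degree over `ℚ(gens 𝕏)` (so generic
embeddings `φ` exist by auxiliary file 1), and contains the division points `exp (x/M!)`.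
-/

noncomputable section

set_option linter.dupNamespace false

open Set
open scoped Matroid
open Literature.ModelTheory.ExponentialFields Literature.ModelTheory.ExponentialFields.ExponentialRing
open Literature.NumberTheory.Transcendental Literature.NumberTheory.Transcendental.GammaField

namespace Summit.Schanuel.Schanuel.Theorems.RigidCore

namespace DoubleBase

variable {τ : ℂ} {N k : ℕ} {c : Fin N → ℂ} {e : Fin k → ℂ}

set_option quotPrecheck false in
/-- `𝕏 = ℚτ + ℚc` (local notation only). -/
local notation "𝕏" =>
  (Submodule.span ℚ ({τ} : Set ℂ) ⊔ Submodule.span ℚ (Set.range c) : Submodule ℚ ℂ)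

set_option quotPrecheck false in
/-- `𝕎 = ℚτ + ℚ(c, e) = 𝕏 + ℚe` (local notation only). -/
local notation "𝕎" => (Submodule.span ℚ ({τ} : Set ℂ) ⊔
  Submodule.span ℚ (Set.range (Fin.append c e)) : Submodule ℚ ℂ)

set_option quotPrecheck false in
/-- `𝔽 = ℚ(𝕎 ∪ exp 𝕎)`, the Γ-field of `𝕎` (local notation only). -/
local notation "𝔽" => (fieldOf (F := ℂ)
  (Submodule.span ℚ ({τ} : Set ℂ) ⊔ Submodule.span ℚ (Set.range (Fin.append c e))))

set_option quotPrecheck false in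
/-- Freeness of `e` over `𝕏` (local notation only). -/
local notation "FreeH" => (∀ m : Fin k → ℤ, m ≠ 0 →
  (∑ j, (m j : ℚ) • e j) ∉ acl (gens 𝕏) ∧ Complex.exp (∑ j, (m j : ℚ) • e j) ∉ acl (gens 𝕏))

set_option quotPrecheck false in
/-- `φ` is the identity on `ℚ(gens 𝕏)` (local notation only). -/
local notation "FixH[" φ "]" => (∀ (x : ℂ) (hx : x ∈ 𝔽), x ∈ fieldOf 𝕏 → φ ⟨x, hx⟩ = x)

set_option quotPrecheck false in
/-- `φ(𝔽)` is algebraically disjoint from `𝔽` over `ℚ(gens 𝕏)` (local notation only). -/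
local notation "RelH[" φ "]" => (∀ S : Set 𝔽,
  (algMatroid ℂ).relRank ((𝔽 : IntermediateField ℚ ℂ) : Set ℂ) (φ '' S) =
    (algMatroid ℂ).relRank (fieldOf 𝕏 : Set ℂ) (φ '' S))

set_option quotPrecheck false in
/-- `e' = φ ∘ e` (local notation only). -/
local notation "EpH[" φ "," e' "]" => (∀ (j : Fin k) (h : e j ∈ 𝔽), φ ⟨e j, h⟩ = e' j)

set_option quotPrecheck false in
/-- The characterising property of the partial exponential `θ` of the double:
`θ(w + Σ qⱼ e'ⱼ) = exp w · φ(exp Σ qⱼ eⱼ)` for `w ∈ 𝕎` (local notation only). -/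
local notation "ThH[" φ "," e' "," θ "]" => (∀ w ∈ 𝕎, ∀ (q : Fin k → ℚ)
  (h : Complex.exp (∑ j, q j • e j) ∈ 𝔽),
  θ (w + ∑ j, q j • e' j) = Complex.exp w * φ ⟨Complex.exp (∑ j, q j • e j), h⟩)

/-! ### Existence of the partial exponential `θ` -/

/-- **The partial exponential of the double exists**: since representations `w + Σ qⱼ e'ⱼ`
(`w ∈ 𝕎`) are unique (`repr_unique`), `θ(w + Σ qⱼ e'ⱼ) := exp w · φ(exp Σ qⱼ eⱼ)` (and `1` off
`𝕎 + ℚe'`) is well defined. -/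
theorem exists_theta {φ : 𝔽 →+* ℂ} {e' : Fin k → ℂ} (he' : EpH[φ, e']) (hlin : LinIndepOver 𝕏 e)
    (hfree : FreeH) (hfix : FixH[φ]) (hrel : RelH[φ]) : ∃ θ : ℂ → ℂ, ThH[φ, e', θ] := by
  classical
  refine ⟨fun z => if h : ∃ p : ℂ × (Fin k → ℚ), p.1 ∈ 𝕎 ∧ z = p.1 + ∑ j, p.2 j • e' j then
      Complex.exp h.choose.1 * φ ⟨Complex.exp (∑ j, h.choose.2 j • e j),
        exp_mem_Fd (sum_smul_e_mem_Wsp τ c e _)⟩ else 1, ?_⟩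
  intro w hw q hq
  have h : ∃ p : ℂ × (Fin k → ℚ), p.1 ∈ 𝕎 ∧ w + ∑ j, q j • e' j = p.1 + ∑ j, p.2 j • e' j :=
    ⟨(w, q), hw, rfl⟩
  dsimp only
  rw [dif_pos h]
  obtain ⟨hp1, hp2⟩ := h.choose_spec
  obtain ⟨h1, h2⟩ := repr_unique he' hlin hfree hfix hrel hp1 hw hp2.symm
  have key : ∀ p : ℂ × (Fin k → ℚ), p.1 = w → p.2 = q →
      Complex.exp p.1 * φ ⟨Complex.exp (∑ j, p.2 j • e j),
        exp_mem_Fd (sum_smul_e_mem_Wsp τ c e _)⟩ =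
      Complex.exp w * φ ⟨Complex.exp (∑ j, q j • e j), hq⟩ := by
    rintro p rfl rfl; rfl
  exact key _ h1 h2

/-! ### Properties of `θ` -/

/-- **`θ = exp` on `𝕎`.** -/
theorem theta_of_mem_W {φ : 𝔽 →+* ℂ} {e' : Fin k → ℂ} {θ : ℂ → ℂ} (hθ : ThH[φ, e', θ])
    {w : ℂ} (hw : w ∈ 𝕎) : θ w = Complex.exp w := by
  have h := hθ w hw 0 (exp_mem_Fd (sum_smul_e_mem_Wsp τ c e 0))
  have h0 : w + ∑ j, (0 : Fin k → ℚ) j • e' j = w := by simp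
  rw [h0] at h
  rw [h]
  have h1 : φ ⟨Complex.exp (∑ j, (0 : Fin k → ℚ) j • e j),
      exp_mem_Fd (sum_smul_e_mem_Wsp τ c e 0)⟩ = 1 := by
    rw [← map_one φ]
    congr 1
    apply Subtype.ext
    change Complex.exp _ = 1
    simp
  rw [h1, mul_one]

/-- **`θ ∘ φ = φ ∘ exp` on `𝕎`** (the second copy). -/
theorem theta_phi {φ : 𝔽 →+* ℂ} {e' : Fin k → ℂ} {θ : ℂ → ℂ} (hθ : ThH[φ, e', θ])
    (he' : EpH[φ, e']) (hfix : FixH[φ]) {w : ℂ} (hw : w ∈ 𝕎) (hwF : w ∈ 𝔽) :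
    θ (φ ⟨w, hwF⟩) = φ ⟨Complex.exp w, exp_mem_Fd hw⟩ := by
  obtain ⟨x, hx, q, rfl⟩ := mem_Wsp_iff.1 hw
  rw [phi_of_mem_W he' hfix hx q hwF,
    hθ x (Xsp_le_Wsp e hx) q (exp_mem_Fd (sum_smul_e_mem_Wsp τ c e q)),
    ← hfix (Complex.exp x) (fieldOf_Xsp_le τ c e (exp_mem_F₀ hx)) (exp_mem_F₀ hx), ← map_mul]
  congr 1
  apply Subtype.ext
  change Complex.exp x * Complex.exp _ = Complex.exp _
  rw [← Complex.exp_add]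

/-- **`θ` is a homomorphism** on `D_ℂ = 𝕎 + ℚe'`. -/
theorem theta_add {φ : 𝔽 →+* ℂ} {e' : Fin k → ℂ} {θ : ℂ → ℂ} (hθ : ThH[φ, e', θ])
    {z₁ z₂ : ℂ} (hz₁ : z₁ ∈ 𝕎 ⊔ Submodule.span ℚ (range e'))
    (hz₂ : z₂ ∈ 𝕎 ⊔ Submodule.span ℚ (range e')) : θ (z₁ + z₂) = θ z₁ * θ z₂ := by
  obtain ⟨w₁, hw₁, q₁, rfl⟩ := mem_Dc_iff.1 hz₁
  obtain ⟨w₂, hw₂, q₂, rfl⟩ := mem_Dc_iff.1 hz₂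
  have hsum : (w₁ + ∑ j, q₁ j • e' j) + (w₂ + ∑ j, q₂ j • e' j) =
      (w₁ + w₂) + ∑ j, (q₁ + q₂) j • e' j := by
    simp only [Pi.add_apply, add_smul, Finset.sum_add_distrib]; ring
  rw [hsum, hθ _ (Submodule.add_mem _ hw₁ hw₂) (q₁ + q₂) (exp_mem_Fd (sum_smul_e_mem_Wsp τ c e _)),
    hθ w₁ hw₁ q₁ (exp_mem_Fd (sum_smul_e_mem_Wsp τ c e _)),
    hθ w₂ hw₂ q₂ (exp_mem_Fd (sum_smul_e_mem_Wsp τ c e _)), Complex.exp_add]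
  have hexp : Complex.exp (∑ j, (q₁ + q₂) j • e j) =
      Complex.exp (∑ j, q₁ j • e j) * Complex.exp (∑ j, q₂ j • e j) := by
    rw [← Complex.exp_add]
    simp only [Pi.add_apply, add_smul, Finset.sum_add_distrib]
  rw [phi_congr φ hexp _ (mul_mem (exp_mem_Fd (sum_smul_e_mem_Wsp τ c e q₁))
    (exp_mem_Fd (sum_smul_e_mem_Wsp τ c e q₂)))]
  rw [show (⟨Complex.exp (∑ j, q₁ j • e j) * Complex.exp (∑ j, q₂ j • e j), _⟩ : 𝔽) =
      ⟨Complex.exp (∑ j, q₁ j • e j), exp_mem_Fd (sum_smul_e_mem_Wsp τ c e q₁)⟩ *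
        ⟨Complex.exp (∑ j, q₂ j • e j), exp_mem_Fd (sum_smul_e_mem_Wsp τ c e q₂)⟩ from
      rfl, map_mul]
  ring

/-- **`θ` takes non-zero values** on `D_ℂ`. -/
theorem theta_ne_zero {φ : 𝔽 →+* ℂ} {e' : Fin k → ℂ} {θ : ℂ → ℂ} (hθ : ThH[φ, e', θ])
    {z : ℂ} (hz : z ∈ 𝕎 ⊔ Submodule.span ℚ (range e')) : θ z ≠ 0 := by
  obtain ⟨w, hw, q, rfl⟩ := mem_Dc_iff.1 hz
  rw [hθ w hw q (exp_mem_Fd (sum_smul_e_mem_Wsp τ c e q))]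
  refine mul_ne_zero (Complex.exp_ne_zero _) ?_
  rw [map_ne_zero_iff φ φ.injective, Ne, Subtype.ext_iff]
  exact Complex.exp_ne_zero _

/-- **The kernel of `θ` on `D_ℂ` is exactly `ℤτ`** (`τ = 2πi`): if `θ(w + Σ qⱼ e'ⱼ) = 1` then
`exp w = φ(exp (-Σ qⱼ eⱼ)) ∈ 𝔽 ∩ φ(𝔽)` is algebraic over `ℚ(gens 𝕏)`, so `w ∈ 𝕏` by
multiplicative freeness; then `φ(exp Σ qⱼ eⱼ) = exp(-w) ∈ ℚ(gens 𝕏)` is fixed by `φ`, so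
`exp (Σ qⱼ eⱼ)` is algebraic over `ℚ(gens 𝕏)`, `Σ qⱼ eⱼ ∈ 𝕏`, `q = 0`, and `exp w = 1`. -/
theorem theta_eq_one_iff {φ : 𝔽 →+* ℂ} {e' : Fin k → ℂ} {θ : ℂ → ℂ} (hθ : ThH[φ, e', θ])
    (hlin : LinIndepOver 𝕏 e) (hfree : FreeH) (hfix : FixH[φ]) (hrel : RelH[φ])
    (hτ : τ = 2 * ↑Real.pi * Complex.I) {z : ℂ} (hz : z ∈ 𝕎 ⊔ Submodule.span ℚ (range e')) :
    θ z = 1 ↔ ∃ n : ℤ, z = n • τ := by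
  constructor
  · intro h1
    obtain ⟨w, hw, q, rfl⟩ := mem_Dc_iff.1 hz
    set u : ℂ := ∑ j, q j • e j with hu
    have huW : u ∈ 𝕎 := sum_smul_e_mem_Wsp τ c e q
    rw [hθ w hw q (exp_mem_Fd huW)] at h1
    have hnegw : Complex.exp (-w) ∈ 𝔽 := exp_mem_Fd (Submodule.neg_mem _ hw)
    have hφu : φ ⟨Complex.exp u, exp_mem_Fd huW⟩ = Complex.exp (-w) := by
      rw [Complex.exp_neg]
      exact eq_inv_of_mul_eq_one_right h1
    -- `exp w` is algebraic over `ℚ(gens 𝕏)`, so `w ∈ 𝕏`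
    have hacl : Complex.exp (-w) ∈ acl (gens 𝕏) := hφu ▸ phi_mem_acl hrel _ (hφu ▸ hnegw)
    have hwacl : Complex.exp w ∈ acl (gens 𝕏) := by
      have := inv_mem_acl hacl
      rwa [Complex.exp_neg, inv_inv] at this
    have hwX : w ∈ 𝕏 := mem_X_of_exp_mem_acl hfree hw hwacl
    -- `φ` fixes `exp (-w)`, so `exp u = exp (-w)` is algebraic over `ℚ(gens 𝕏)` and `u ∈ 𝕏`
    have hfixw : φ ⟨Complex.exp (-w), hnegw⟩ = Complex.exp (-w) :=
      hfix _ hnegw (exp_mem_F₀ (Submodule.neg_mem _ hwX))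
    have hequ : Complex.exp u = Complex.exp (-w) :=
      congrArg Subtype.val (φ.injective (hφu.trans hfixw.symm))
    have huacl : Complex.exp u ∈ acl (gens 𝕏) :=
      hequ ▸ fieldOf_subset_acl _ (exp_mem_F₀ (Submodule.neg_mem _ hwX))
    have huX : u ∈ 𝕏 := mem_X_of_exp_mem_acl hfree huW huacl
    have hq : q = 0 := hlin q huX
    subst hq
    have hu0 : u = 0 := by simp [hu]
    -- so `exp w = 1`
    have hexpw : Complex.exp w = 1 := by
      have h2 : φ ⟨Complex.exp u, exp_mem_Fd huW⟩ = 1 := by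
        rw [← map_one φ]
        congr 1
        apply Subtype.ext
        change Complex.exp u = 1
        rw [hu0, Complex.exp_zero]
      rw [h2, mul_one] at h1
      exact h1
    obtain ⟨n, hn⟩ := Complex.exp_eq_one_iff.1 hexpw
    rw [← hτ] at hn
    refine ⟨n, ?_⟩
    rw [zsmul_eq_mul, ← hn]
    simp
  · rintro ⟨n, rfl⟩
    have hmem : (n • τ : ℂ) ∈ 𝕎 := Xsp_le_Wsp e (zsmul_mem (tau_mem_Xsp τ c) n)
    rw [theta_of_mem_W hθ hmem, zsmul_eq_mul, hτ]
    exact Complex.exp_int_mul_two_pi_mul_I n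

/-! ### Countability and finite type of `𝔽`; division points -/

variable (τ c e) in
/-- `𝕎` is countable. -/
theorem countable_Wsp : ((𝕎 : Submodule ℚ ℂ) : Set ℂ).Countable := by
  let g : ℚ × (Fin N → ℚ) × (Fin k → ℚ) → ℂ :=
    fun p => p.1 • τ + ∑ i, p.2.1 i • c i + ∑ j, p.2.2 j • e j
  refine (countable_range g).mono ?_
  intro z hz
  rw [SetLike.mem_coe, mem_Wsp_iff] at hz
  obtain ⟨x, hx, q, rfl⟩ := hz
  rw [Submodule.mem_sup] at hx
  obtain ⟨y, hy, v, hv, rfl⟩ := hx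
  obtain ⟨a, rfl⟩ := Submodule.mem_span_singleton.1 hy
  obtain ⟨b, rfl⟩ := (Submodule.mem_span_range_iff_exists_fun ℚ).1 hv
  exact ⟨(a, b, q), rfl⟩

variable (τ c e) in
/-- `𝕎` is finitely generated over `𝕏`. -/
theorem isFG_Xsp_Wsp : IsFG 𝕏 𝕎 := by
  have h : IsFG 𝕏 (Submodule.span ℚ (({τ} : Set ℂ) ∪ range (Fin.append c e))) :=
    isFG_span_of_finite _ ((finite_singleton τ).union (finite_range _))
  rwa [Submodule.span_union] at h

variable (τ c e) in
/-- `𝔽` is countable. -/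
theorem countable_Fd : ((𝔽 : IntermediateField ℚ ℂ) : Set ℂ).Countable :=
  (countable_acl ((countable_Wsp τ c e).union ((countable_Wsp τ c e).image _))).mono
    (fieldOf_subset_acl _)

variable (τ c e) in
/-- `𝔽` has finite transcendence degree over `ℚ(gens 𝕏)` (at most `td(𝕎/𝕏) < ∞`). -/
theorem relRank_fieldOf_Fd_lt_top :
    (algMatroid ℂ).relRank (fieldOf 𝕏 : Set ℂ) ((𝔽 : IntermediateField ℚ ℂ) : Set ℂ) < ⊤ := by
  have h1 : (algMatroid ℂ).relRank (fieldOf 𝕏 : Set ℂ) ((𝔽 : IntermediateField ℚ ℂ) : Set ℂ) ≤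
      (algMatroid ℂ).relRank (gens 𝕏) ((𝔽 : IntermediateField ℚ ℂ) : Set ℂ) :=
    (algMatroid ℂ).relRank_anti_left _ (gens_subset_fieldOf _)
  have h2 : (algMatroid ℂ).relRank (gens 𝕏) ((𝔽 : IntermediateField ℚ ℂ) : Set ℂ) ≤
      (algMatroid ℂ).relRank (gens 𝕏) (gens 𝕎) := by
    refine (algMatroid ℂ).relRank_le_of_subset_closure _ ?_
    exact (fieldOf_subset_acl _).trans (acl_mono subset_union_left)
  have h3 : (algMatroid ℂ).relRank (gens 𝕏) (gens 𝕎) < ⊤ := td_lt_top (isFG_Xsp_Wsp τ c e)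
  exact lt_of_le_of_lt (h1.trans h2) h3

/-- `𝔽` contains `𝕎` and all the division points `exp (x / M!)`, `x ∈ 𝕎`. -/
theorem mem_Fd_and_exp_div_mem {x : ℂ} (hx : x ∈ 𝕎) :
    x ∈ 𝔽 ∧ ∀ M : ℕ, Complex.exp (x / (M.factorial : ℂ)) ∈ 𝔽 := by
  refine ⟨mem_Fd_of_mem hx, fun M => exp_mem_Fd ?_⟩
  have : x / (M.factorial : ℂ) = ((M.factorial : ℚ)⁻¹) • x := by
    rw [Rat.smul_def, Rat.cast_inv, Rat.cast_natCast, div_eq_inv_mul]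
  rw [this]
  exact Submodule.smul_mem _ _ hx

/-- `exp (y / M!) ∈ ℚ(gens 𝕏)` for `y ∈ 𝕏`. -/
theorem exp_div_mem_F₀ {y : ℂ} (hy : y ∈ 𝕏) (M : ℕ) :
    Complex.exp (y / (M.factorial : ℂ)) ∈ fieldOf 𝕏 := by
  refine exp_mem_F₀ ?_
  have : y / (M.factorial : ℂ) = ((M.factorial : ℚ)⁻¹) • y := by
    rw [Rat.smul_def, Rat.cast_inv, Rat.cast_natCast, div_eq_inv_mul]
  rw [this]
  exact Submodule.smul_mem _ _ hy

end DoubleBase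


/-- **Registered sub-goal of `stub_doubleBase` (auxiliary file 3): the partial exponential of the
double exists** — `DoubleBase.exists_theta` restated without local notations. -/
theorem doubleBase_exists_theta (τ : ℂ) {N k : ℕ} (c : Fin N → ℂ) (e : Fin k → ℂ)
    (φ : fieldOf (Submodule.span ℚ ({τ} : Set ℂ) ⊔ Submodule.span ℚ (range (Fin.append c e))) →+* ℂ)
    (e' : Fin k → ℂ)
    (he' : ∀ (j : Fin k) (h : e j ∈ fieldOf (Submodule.span ℚ ({τ} : Set ℂ) ⊔ Submodule.span ℚ (range (Fin.append c e)))),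
      φ ⟨e j, h⟩ = e' j)
    (hlin : LinIndepOver (Submodule.span ℚ ({τ} : Set ℂ) ⊔ Submodule.span ℚ (range c)) e)
    (hfree : ∀ m : Fin k → ℤ, m ≠ 0 →
      (∑ j, (m j : ℚ) • e j) ∉ acl (gens (Submodule.span ℚ ({τ} : Set ℂ) ⊔ Submodule.span ℚ (range c))) ∧
      Complex.exp (∑ j, (m j : ℚ) • e j) ∉ acl (gens (Submodule.span ℚ ({τ} : Set ℂ) ⊔ Submodule.span ℚ (range c))))
    (hfix : ∀ (x : ℂ) (hx : x ∈ fieldOf (Submodule.span ℚ ({τ} : Set ℂ) ⊔ Submodule.span ℚ (range (Fin.append c e)))),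
      x ∈ fieldOf (Submodule.span ℚ ({τ} : Set ℂ) ⊔ Submodule.span ℚ (range c)) → φ ⟨x, hx⟩ = x)
    (hrel : ∀ S : Set (fieldOf (Submodule.span ℚ ({τ} : Set ℂ) ⊔ Submodule.span ℚ (range (Fin.append c e)))),
      (algMatroid ℂ).relRank ((fieldOf (Submodule.span ℚ ({τ} : Set ℂ) ⊔ Submodule.span ℚ (range (Fin.append c e))) :
        IntermediateField ℚ ℂ) : Set ℂ) (φ '' S) =
      (algMatroid ℂ).relRank (fieldOf (Submodule.span ℚ ({τ} : Set ℂ) ⊔ Submodule.span ℚ (range c)) : Set ℂ) (φ '' S)) :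
    ∃ θ : ℂ → ℂ, ∀ w ∈ Submodule.span ℚ ({τ} : Set ℂ) ⊔ Submodule.span ℚ (range (Fin.append c e)), ∀ (q : Fin k → ℚ)
      (h : Complex.exp (∑ j, q j • e j) ∈ fieldOf (Submodule.span ℚ ({τ} : Set ℂ) ⊔ Submodule.span ℚ (range (Fin.append c e)))),
      θ (w + ∑ j, q j • e' j) = Complex.exp w * φ ⟨Complex.exp (∑ j, q j • e j), h⟩ :=
  DoubleBase.exists_theta he' hlin hfree hfix hrel

end Summit.Schanuel.Schanuel.Theorems.RigidCore
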